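import Summits.QuantumFields.BalabanUV.Beta.WardLocusCubic
import Summits.QuantumFields.BalabanUV.Beta.WilsonDivergenceContact
import Summits.QuantumFields.BalabanUV.Beta.KernelWardHColumnWall
import Summits.QuantumFields.BalabanUV.Beta.SecondOrderUnits

/-!
# `BalabanUV.Beta.WardLocusInduction` — binder row D1, the WARD binder hW: THE BLOCK STENCIL WARD SOCKET `hSd` AT EVERY LEVEL BY
# INDUCTION ON THE LEVEL, resolvent-generic, for step stencils typed RECURSIVELY over the step resolvents; + the hW-side UNITS PIN

HONEST FRAMING (cell charter, verbatim): «discharging `BetaPertH` makes Bałaban's UV stability UNCONDITIONAL — a real constructive-QFT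
result; it is NOT the continuum limit and NOT the Clay problem.»  DERIVED cell leaf (pub-balaban β sub-cell, D1 formalisation swarm seat
`b2b-balaban-beta-d1-formalise-leaf-10`, gen 2; sequel of this lineage's `WardLocusStencils` p208946 / `WardLocusS0N` p209131 /
`WardLocusStep` p209548 / `WardLocusCubic` p209851 on an1-g25's hW skeleton `HOME/b2b-balaban-beta-an1-g25/SKELETON-D1-hW.v1.md` §2, item
(W-LS)); every declaration is [folklore] kernel algebra (or real arithmetic) over objects ALREADY in the tree, cited BY NAME; no statement of
Bałaban's papers is typed, no `[cite:]` tag, no `def`; it instantiates NO binder of the β-function wall.  NOT `BetaPertH`, NOT continuum, NOT Clay.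
HONEST DEPENDENCY (cell records, verbatim): «continuum YM on T⁴ ⇐ BetaPertH ∧ nine spine estimates (0/9 proved); BetaPertH ⇐ (D1) ∧ (D4) ∧
CAP+tail; G-an2-4 gates asym, D1 and NE2/3/4.»
ABSOLUTE RULE (cell charter, verbatim): «No internally-minted statement may enter as a cited fact. Every hypothesis is either kernel-proved in
this package or a verbatim quotation of a PUBLISHED theorem with page reference. The manuscript(s) under audit are NOT citable for their own
disputed steps — they are the thing under adjudication; programme-internal (2001/route/tribunal) claims are never citable.»

THE POINT.  The hW root (an1 `KernelWardRelativeEnd.…_ctrC`, an2 `…_ctrC_relInv` p209532, an1-g26 per level) consumes AT EVERY LEVEL `j`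
the block stencil Ward law `hSd j : cH j • Σ_{v ∈ box Lc} divV (S j) (Lc•y + v) = conjV (𝕄 j) (diagK (ξ j • Σ_v legInd ρ (Lc•y + v)))`
TOGETHER WITH the ℋ-column Ward law `hH j` of the step propagator `G j` (same constant `cH j`) and `RelInv (G j) (𝕄 j) E`.  This lineage's
`WardLocusCubic.divV_e3K_eq_conjV` says these three level-`j` facts ALONE give the pure-gauge divergence of the value-function cubic jet
`e3K (G j) Lc (S j)` (the step-`j` stencil dressed by the step-`j` propagator's own ℋ-columns and sandwiched — B12's inductive definition of
the next cubic vertex, read on the multiplier block).  Hence IF the step-`(j+1)` stencil is TYPED RECURSIVELY — divergence = cubic sector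
`a (j+1) • divV (e3K (G j) Lc (S j))` + border sector `b (j+1) • divV (vhSAt ρ)` (Λ-null: `WardLocusStep.divV_SLam_eq_zero_of_coeffDiv`) —
and `𝕄 (j+1)` has field block `w (j+1) • mmRead Lc (G j)` and border `P (j+1) •` that of `bhKAt`, THEN `hSd (j+1) ⟸ hSd j` under two
SCALAR LOCKS (`hSd_step`), and `∀ j, hSd j` by induction (`hSd_all`).  For the wall's OWN families `G j = coDressKBmAt ρ_c Lc (KInvStep Lc j)`,
`𝕄 j = bhKStepAt d ρ_c Lc j`, `E = axEc ρ_c Lc` every level-independent input is LANDED: `hH` ∀ j (leaf-07 `colH_ward_KInvStep_all`,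
`cH j = (stepScale j·Lc^{d+1})⁻¹`), `RelInv` ∀ j (an2 `relInv_coDressKBmAt_KInvStep_bhKStepAt` p209364), the dictionary
`ffK (bhKStepAt (j+1)) = wVH (j+1) • mmRead Lc (G j)` (§1), the level-`0` law (leaf-05 `WilsonDivergenceContact.hSd_S0NAt_of_lock`, Wilson
constant `1/2`) — `hSd_wall_all_S0NAt` leaves on the S-side ONLY the recursion hypothesis tying the family, the generator localisation `hX`
(kept as the root keeps it; an1-g26's `KernelWardLevels.loc_diagK_smul_sum_legInd` discharges it) and the scalar locks.
THE UNITS PIN (§4, real arithmetic).  With leaf-07's `cH j`, `wVH j = (stepScale j)²`, border scale `stepScale j·Lc^{d+1}`, the step locks hold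
for ALL `j` (given the level-`0` lock `ξ 0 = cE·cE′/Lc^{d+1}`, `cVH = −cE·cE′·Lc^{d+1}`) IFF `ξ` is CONSTANT and `cE·wE′ (j+1) = (stepScale (j+1))³·Lc^{d+1}`
(`stepLocks_iff`): at the BCJ v1.2 numeral `wE′ = wE` this is **`cE = Lc^{d+1}`** (`stepLocks_bcj_iff`), at `cE = 2` the re-pin
**`wE′ (j+1) = wE (j+1)·Lc^{d+1}/2`** (`stepLocks_two_iff`) — THE SAME relation an3-g29 (l.6419 (4)) / an2-g15 (C-an2-75(b):
`cE = wVH(1)²·Lc^{d+1}/(s·wE(1))`) got from the REFLECTION binder: two kernel symmetries, one re-pin.  Which re-pin is Bałaban's is the units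
owners' ruling ((R45)); this module supplies the hW-side constraint only.
SCOPE (honest).  The wall literal `SpineRooted.JsBalBmNAtOf` types its cubic sector at `j ≥ 1` over the STRAIGHT one-shot resolvent (`e3NAtOf`),
for which no law is claimed (an3-g29 toy verdict; an2's (L3-D) re-typing in progress; `ValueJetGeneric.e3OfK N K S` = `WardLocusCubic.e3K K N S`);
the theorems serve whichever RECURSIVELY typed family the row owner lands.  Closes the S-side of ONE socket (hSd) of ONE binder (hW) of ONE route
to ONE conjunct (D1) modulo the units pin and the W-side (L4); 0 wall binders instantiated.
-/

noncomputable section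

open Finset
open scoped BigOperators
open Literature.MathematicalPhysics.QuantumFieldTheory
open Literature.MathematicalPhysics.QuantumFieldTheory.Balaban1983to89
open Literature.MathematicalPhysics.QuantumFieldTheory.Balaban1983to89.Beta
open ExpKernelCalculus (MKer Decays comp)
open OneStepResolventKernel (Fib KInv LocStencil)
open OneStepKernelFamily (KInvStep colH)
open KernelWard (divV)
open AffineAveraging (box toSite)
open AveragingHessianKernelsRooted (vhSAt)
open BalabanStepJetsSucc (mmRead mmRead_inl_inl mmRead_inr_left mmRead_inr_right wE wVH E2)
open Summit.QuantumFields.BalabanUV.Beta.TameKernelCalculus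
open Summit.QuantumFields.BalabanUV.Beta.ChartConjugation (conjV)
open Summit.QuantumFields.BalabanUV.Beta.ChartConjugationRelative (RelInv)
open Summit.QuantumFields.BalabanUV.Beta.AxialDressingRooted (axEc piKBm piKBm_inl_inr piKBm_inr_inr coDressKBmAt coDressKBmAt_eq
  comp_piKBm_inr tsum_point' spr_axEc decays_coDressKBmAt_KInvStep)
open Summit.QuantumFields.BalabanUV.Beta.BorderedHessian (bhKAt bhKStepAt stepScale stepScale_ne_zero diagK comp_axEc_diagK_comm
  spr_bhKStepAt relInv_coDressKBmAt_KInvStep_bhKStepAt)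
open Summit.QuantumFields.BalabanUV.Beta.AveragingWardRootedStencils (legInd)
open Summit.QuantumFields.BalabanUV.Beta.SpineRooted (S0NAt)
open Summit.QuantumFields.BalabanUV.Beta.KernelWardRelative (gaugeWt)
open Summit.QuantumFields.BalabanUV.Beta.KernelWardHColumnWall (colH_ward_KInvStep_all)
open Summit.QuantumFields.BalabanUV.Beta.WardLocusStencils (ffK)
open Summit.QuantumFields.BalabanUV.Beta.WardLocusS0N (conjV_diagK_smul conjV_diagK_sum)
open Summit.QuantumFields.BalabanUV.Beta.WardLocusStep (conjV_bhKStepAt_succ_diagK_legInd)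
open Summit.QuantumFields.BalabanUV.Beta.WardLocusCubic (e3K divV_e3K_eq_conjV conjV_smul_diagK ffK_bhKStepAt_succ)
open Summit.QuantumFields.BalabanUV.Beta.WilsonDivergenceContact (hSd_S0NAt_of_lock)
open Summit.QuantumFields.BalabanUV.Beta.SecondOrderUnits (KInvStep_mm_eq_KInv_mm)

namespace Summit.QuantumFields.BalabanUV.Beta.WardLocusInduction

variable {d : ℕ}

/-! ## §1 The step Hessian dictionary: the field block of `bhKStepAt (j+1)` is the `mm`-read of the step propagator `G_j` -/

section Dictionary

/-- [folklore] **THE BLOCK-MEAN CO-DRESSING DOES NOT TOUCH THE MULTIPLIER BLOCK**: `(Π_bmᵀ ∘ K ∘ Π_bm)((x, inr m), (z, inr m′)) = K((x, inr m), (z, inr m′))`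
(`piKBm` is the identity on multiplier legs and has no field–multiplier entries). -/
theorem coDressKBmAt_inr_inr (ρ : Fin (d + 1) → ℤ) (N : ℕ) (K : MKer (d + 1) (Fib d)) (x z : Fin (d + 1) → ℤ) (m m' : Fin (d + 1)) :
    coDressKBmAt ρ N K x z (Sum.inr m) (Sum.inr m') = K x z (Sum.inr m) (Sum.inr m') := by
  rw [coDressKBmAt_eq, comp_piKBm_inr]
  unfold ExpKernelCalculus.comp
  have h : ∀ u, ∑ g : Fib d, trK (piKBm ρ N) x u (Sum.inr m) g * K u z g (Sum.inr m') =
      if u = x then K u z (Sum.inr m) (Sum.inr m') else 0 := by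
    intro u
    rw [Fintype.sum_sum_type]
    simp only [trK_apply, piKBm_inl_inr, zero_mul, Finset.sum_const_zero, zero_add, piKBm_inr_inr]
    by_cases hu : u = x
    · rw [if_pos hu]
      rw [Finset.sum_eq_single m (fun m'' _ hm => by rw [if_neg (fun h => hm h.2), zero_mul]) (fun h => absurd (Finset.mem_univ m) h)]
      rw [if_pos ⟨hu, rfl⟩, one_mul]
    · rw [if_neg hu]
      exact Finset.sum_eq_zero fun m'' _ => by rw [if_neg (fun h => hu h.1), zero_mul]
  simp_rw [h]
  exact tsum_point' x fun u => K u z (Sum.inr m) (Sum.inr m')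

variable {Lc : ℕ} [NeZero Lc]

/-- [folklore] **THE `mm`-READ OF THE STEP PROPAGATOR IS THE NEXT VALUE HESSIAN**: for every root `ρ` and every `j`,
`mmRead Lc (coDressKBmAt ρ Lc (KInvStep Lc j)) = E2 d Lc (j+1)` (multiplier legs of an4's `dec` carry weight one:
`SecondOrderUnits.KInvStep_mm_eq_KInv_mm`; the co-dressing is the identity there: `coDressKBmAt_inr_inr`). -/
theorem mmRead_coDressKBmAt_KInvStep (ρ : Fin (d + 1) → ℤ) (j : ℕ) :
    mmRead Lc (coDressKBmAt ρ Lc (KInvStep (d := d) Lc j)) = E2 d Lc (j + 1) := by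
  funext x z a b
  rcases a with α | μ <;> rcases b with β | ν
  · rw [mmRead_inl_inl, coDressKBmAt_inr_inr, KInvStep_mm_eq_KInv_mm]
    unfold BalabanStepJetsSucc.E2
    rw [mmRead_inl_inl]
  · unfold BalabanStepJetsSucc.E2; rw [mmRead_inr_right, mmRead_inr_right]
  · unfold BalabanStepJetsSucc.E2; rw [mmRead_inr_left, mmRead_inr_left]
  · unfold BalabanStepJetsSucc.E2; rw [mmRead_inr_left, mmRead_inr_left]

/-- [folklore] **THE DIAGONAL CONTACT OF THE STEP HESSIAN, PROPAGATOR FORM**: for an in-block root `ρ = toSite r` (`Lc ≥ 1`),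
`conjV (bhKStepAt d ρ Lc (j+1)) (diagK (legInd ρ u)) = wVH (j+1) • conjV (mmRead Lc G_j) (diagK (legInd ρ u)) − (stepScale (j+1)·Lc^{d+1}) • divV (vhSAt ρ) u`
with `G_j = coDressKBmAt ρ Lc (KInvStep Lc j)` — the hypothesis `hM'` of `hSd_step` for the wall's own Hessian / propagator pair. -/
theorem conjV_bhKStepAt_succ_diagK_legInd_step (hLc : 1 ≤ Lc) (ρ : Fin (d + 1) → ℤ) (j : ℕ) (u : Fin (d + 1) → ℤ) :
    conjV (bhKStepAt d ρ Lc (j + 1)) (diagK (legInd ρ u)) =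
      wVH d Lc (j + 1) • conjV (mmRead Lc (coDressKBmAt ρ Lc (KInvStep (d := d) Lc j))) (diagK (legInd ρ u)) -
        (stepScale d Lc (j + 1) * (Lc : ℝ) ^ (d + 1)) • divV (vhSAt ρ d Lc) u := by
  rw [conjV_bhKStepAt_succ_diagK_legInd ρ Lc hLc j u, ffK_bhKStepAt_succ, mmRead_coDressKBmAt_KInvStep, conjV_smul_diagK]
  rfl

end Dictionary

/-! ## §2 THE INDUCTION STEP, resolvent-generic -/

section Step

variable {Lc : ℕ} [NeZero Lc]

omit [NeZero Lc] in
/-- [folklore] **THE BLOCK STENCIL WARD LAW PROPAGATES ONE LEVEL UP** (resolvent-generic).  Level-`j` data: a decaying packed resolvent `K`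
(blocking `Lc`) with `RelInv K M E`, a local stencil family `S`, an in-block root `ρ = toSite r`, constants `(cH, ξ)`; hypotheses (hH) ℋ-column
Ward law of `K`, (hX)/(hEX) the block rotation generator is localised and commutes with `E`, (hSd) THE BLOCK STENCIL WARD LAW of `S` w.r.t. `M`.
Next-level shape: (hT) `divV T u = a • divV (e3K K Lc S) u + b • divV (vhSAt ρ) u`, (hM′) `conjV M′ (diagK (legInd ρ u)) = w • conjV (mmRead Lc K)
(diagK (legInd ρ u)) − P • divV (vhSAt ρ) u`.  Conclusion: under the SCALAR LOCKS `cH′·a·ξ = ξ′·w`, `cH′·b = −ξ′·P`, the block stencil Ward law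
of `T` w.r.t. `M′` with `(cH′, ξ′)`.  Mechanism: `WardLocusCubic.divV_e3K_eq_conjV` + linearity of the diagonal contact in its symbol. -/
theorem hSd_step (hLc : 1 ≤ Lc) {r : Fin (d + 1) → ℕ} (hr : r ∈ box (d + 1) Lc) {K M E : MKer (d + 1) (Fib d)}
    (hKd : ∃ δ C : ℝ, 0 < δ ∧ 0 ≤ C ∧ Decays K C δ) (hM : Spr M) (hE : Spr E) (hR : RelInv K M E)
    {S : Fin (d + 1) → (Fin (d + 1) → ℤ) → MKer (d + 1) (Fib d)} {Cs δs : ℝ} (hS : LocStencil S Cs δs) (hδs : 0 < δs) {cH ξ : ℝ}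
    (hH : ∀ (y : Fin (d + 1) → ℤ) (κ' : Fin (d + 1)) (u : Fin (d + 1) → ℤ),
      ∑ μ, (colH K Lc μ (y - B6BondElimination.unitVec μ) κ' u - colH K Lc μ y κ' u) = cH * gaugeWt Lc y κ' u)
    (hX : ∀ y : Fin (d + 1) → ℤ, Loc (diagK (ξ • ∑ v ∈ box (d + 1) Lc, legInd (toSite r) ((Lc : ℤ) • y + toSite v))))
    (hEX : ∀ y : Fin (d + 1) → ℤ, comp E (diagK (ξ • ∑ v ∈ box (d + 1) Lc, legInd (toSite r) ((Lc : ℤ) • y + toSite v))) =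
      comp (diagK (ξ • ∑ v ∈ box (d + 1) Lc, legInd (toSite r) ((Lc : ℤ) • y + toSite v))) E)
    (hSd : ∀ y : Fin (d + 1) → ℤ, cH • ∑ v ∈ box (d + 1) Lc, divV S ((Lc : ℤ) • y + toSite v) =
      conjV M (diagK (ξ • ∑ v ∈ box (d + 1) Lc, legInd (toSite r) ((Lc : ℤ) • y + toSite v))))
    {T : Fin (d + 1) → (Fin (d + 1) → ℤ) → MKer (d + 1) (Fib d)} {a b : ℝ}
    (hT : ∀ u : Fin (d + 1) → ℤ, divV T u = a • divV (e3K K Lc S) u + b • divV (vhSAt (toSite r) d Lc) u)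
    {M' : MKer (d + 1) (Fib d)} {w P : ℝ}
    (hM' : ∀ u : Fin (d + 1) → ℤ, conjV M' (diagK (legInd (toSite r) u)) =
      w • conjV (mmRead Lc K) (diagK (legInd (toSite r) u)) - P • divV (vhSAt (toSite r) d Lc) u)
    {cH' ξ' : ℝ} (h₁ : cH' * a * ξ = ξ' * w) (h₂ : cH' * b = -(ξ' * P)) (y : Fin (d + 1) → ℤ) :
    cH' • ∑ v ∈ box (d + 1) Lc, divV T ((Lc : ℤ) • y + toSite v) =
      conjV M' (diagK (ξ' • ∑ v ∈ box (d + 1) Lc, legInd (toSite r) ((Lc : ℤ) • y + toSite v))) := by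
  -- the cubic Ward law at this level, from the three level-`j` facts (this lineage's `WardLocusCubic`)
  have hc : ∀ u : Fin (d + 1) → ℤ, divV (e3K K Lc S) u = ξ • conjV (mmRead Lc K) (diagK (legInd (toSite r) u)) := fun u =>
    divV_e3K_eq_conjV hKd hM hE hR hLc hS hδs hr cH ξ hH hX hEX hSd (toSite r) u
  -- pointwise in the fine site
  have key : ∀ u : Fin (d + 1) → ℤ, cH' • divV T u = ξ' • conjV M' (diagK (legInd (toSite r) u)) := by
    intro u
    calc cH' • divV T u
        = (cH' * a * ξ) • conjV (mmRead Lc K) (diagK (legInd (toSite r) u)) + (cH' * b) • divV (vhSAt (toSite r) d Lc) u := by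
          rw [hT u, hc u, smul_add, smul_smul, smul_smul, smul_smul]
      _ = (ξ' * w) • conjV (mmRead Lc K) (diagK (legInd (toSite r) u)) + (-(ξ' * P)) • divV (vhSAt (toSite r) d Lc) u := by
          rw [h₁, h₂]
      _ = ξ' • conjV M' (diagK (legInd (toSite r) u)) := by
          rw [hM' u, smul_sub, smul_smul, smul_smul, neg_smul, sub_eq_add_neg]
  rw [Finset.smul_sum, conjV_diagK_smul, conjV_diagK_sum, Finset.smul_sum]
  exact Finset.sum_congr rfl fun v _ => key _

end Step

/-! ## §3 ALL LEVELS BY INDUCTION — generic families, then the wall's own propagator / Hessian / projector families -/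

section All

variable {Lc : ℕ} [NeZero Lc]

omit [NeZero Lc] in
/-- [folklore] **THE BLOCK STENCIL WARD LAW AT EVERY LEVEL, BY INDUCTION** (generic families).  Level-indexed data: resolvents `K j`, Hessians
`M j`, one projector `E`, stencil families `S j`, constants `cH ξ a b w P : ℕ → ℝ`.  If every level carries (hH), (hX), (hEX), the families are
tied by the RECURSIVE next-level shape (hT: the cubic sector of `S (j+1)` is `e3K (K j) Lc (S j)`) and (hM′), the scalar locks hold at every
step, and the level-`0` law (h0) holds, then `hSd j` holds for every `j`. -/
theorem hSd_all (hLc : 1 ≤ Lc) {r : Fin (d + 1) → ℕ} (hr : r ∈ box (d + 1) Lc) {K M : ℕ → MKer (d + 1) (Fib d)} {E : MKer (d + 1) (Fib d)}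
    (hKd : ∀ j, ∃ δ C : ℝ, 0 < δ ∧ 0 ≤ C ∧ Decays (K j) C δ) (hM : ∀ j, Spr (M j)) (hE : Spr E) (hR : ∀ j, RelInv (K j) (M j) E)
    {S : ℕ → Fin (d + 1) → (Fin (d + 1) → ℤ) → MKer (d + 1) (Fib d)} {Cs δs : ℕ → ℝ} (hS : ∀ j, LocStencil (S j) (Cs j) (δs j))
    (hδs : ∀ j, 0 < δs j) {cH ξ : ℕ → ℝ}
    (hH : ∀ (j : ℕ) (y : Fin (d + 1) → ℤ) (κ' : Fin (d + 1)) (u : Fin (d + 1) → ℤ),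
      ∑ μ, (colH (K j) Lc μ (y - B6BondElimination.unitVec μ) κ' u - colH (K j) Lc μ y κ' u) = cH j * gaugeWt Lc y κ' u)
    (hX : ∀ (j : ℕ) (y : Fin (d + 1) → ℤ), Loc (diagK (ξ j • ∑ v ∈ box (d + 1) Lc, legInd (toSite r) ((Lc : ℤ) • y + toSite v))))
    (hEX : ∀ (j : ℕ) (y : Fin (d + 1) → ℤ), comp E (diagK (ξ j • ∑ v ∈ box (d + 1) Lc, legInd (toSite r) ((Lc : ℤ) • y + toSite v))) =
      comp (diagK (ξ j • ∑ v ∈ box (d + 1) Lc, legInd (toSite r) ((Lc : ℤ) • y + toSite v))) E)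
    {a b w P : ℕ → ℝ}
    (hT : ∀ (j : ℕ) (u : Fin (d + 1) → ℤ),
      divV (S (j + 1)) u = a (j + 1) • divV (e3K (K j) Lc (S j)) u + b (j + 1) • divV (vhSAt (toSite r) d Lc) u)
    (hM' : ∀ (j : ℕ) (u : Fin (d + 1) → ℤ), conjV (M (j + 1)) (diagK (legInd (toSite r) u)) =
      w (j + 1) • conjV (mmRead Lc (K j)) (diagK (legInd (toSite r) u)) - P (j + 1) • divV (vhSAt (toSite r) d Lc) u)
    (h₁ : ∀ j, cH (j + 1) * a (j + 1) * ξ j = ξ (j + 1) * w (j + 1)) (h₂ : ∀ j, cH (j + 1) * b (j + 1) = -(ξ (j + 1) * P (j + 1)))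
    (h0 : ∀ y : Fin (d + 1) → ℤ, cH 0 • ∑ v ∈ box (d + 1) Lc, divV (S 0) ((Lc : ℤ) • y + toSite v) =
      conjV (M 0) (diagK (ξ 0 • ∑ v ∈ box (d + 1) Lc, legInd (toSite r) ((Lc : ℤ) • y + toSite v)))) :
    ∀ (j : ℕ) (y : Fin (d + 1) → ℤ), cH j • ∑ v ∈ box (d + 1) Lc, divV (S j) ((Lc : ℤ) • y + toSite v) =
      conjV (M j) (diagK (ξ j • ∑ v ∈ box (d + 1) Lc, legInd (toSite r) ((Lc : ℤ) • y + toSite v))) := by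
  intro j
  induction j with
  | zero => exact h0
  | succ j ih =>
    intro y
    exact hSd_step hLc hr (hKd j) (hM j) hE (hR j) (hS j) (hδs j) (hH j) (hX j) (hEX j) ih (hT j) (hM' j) (h₁ j) (h₂ j) y

/-- [folklore] **THE BLOCK STENCIL WARD SOCKET OF THE hW ROOT AT EVERY LEVEL, FOR THE WALL'S OWN PROPAGATORS AND HESSIANS** `G j :=
coDressKBmAt ρ Lc (KInvStep Lc j)`, `𝕄 j := bhKStepAt d ρ Lc j`, `E := axEc ρ Lc`, `cH j := (stepScale j·Lc^{d+1})⁻¹` (in-block root `ρ = toSite r`):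
every level-independent input is a LANDED theorem (`decays_coDressKBmAt_KInvStep`, `spr_bhKStepAt`, `spr_axEc`, `relInv_coDressKBmAt_KInvStep_bhKStepAt`,
`colH_ward_KInvStep_all`, `comp_axEc_diagK_comm`, `conjV_bhKStepAt_succ_diagK_legInd_step`).  For ANY level-indexed local stencil family `S` with
the level-`0` law (h0) and the RECURSIVE tie (hT) `divV (S (j+1)) u = a (j+1) • divV (e3K (G j) Lc (S j)) u + b (j+1) • divV (vhSAt ρ) u`, and
scales `ξ` obeying the locks: `∀ j y, cH j • Σ_v divV (S j) (Lc•y + v) = conjV (𝕄 j) (diagK (ξ j • Σ_v legInd ρ (Lc•y + v)))`. -/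
theorem hSd_wall_all (hLc : 1 ≤ Lc) {r : Fin (d + 1) → ℕ} (hr : r ∈ box (d + 1) Lc)
    {S : ℕ → Fin (d + 1) → (Fin (d + 1) → ℤ) → MKer (d + 1) (Fib d)} {Cs δs : ℕ → ℝ} (hS : ∀ j, LocStencil (S j) (Cs j) (δs j))
    (hδs : ∀ j, 0 < δs j) {ξ a b : ℕ → ℝ}
    (hX : ∀ (j : ℕ) (y : Fin (d + 1) → ℤ), Loc (diagK (ξ j • ∑ v ∈ box (d + 1) Lc, legInd (toSite r) ((Lc : ℤ) • y + toSite v))))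
    (hT : ∀ (j : ℕ) (u : Fin (d + 1) → ℤ), divV (S (j + 1)) u =
      a (j + 1) • divV (e3K (coDressKBmAt (toSite r) Lc (KInvStep (d := d) Lc j)) Lc (S j)) u + b (j + 1) • divV (vhSAt (toSite r) d Lc) u)
    (h₁ : ∀ j, (stepScale d Lc (j + 1) * (Lc : ℝ) ^ (d + 1))⁻¹ * a (j + 1) * ξ j = ξ (j + 1) * wVH d Lc (j + 1))
    (h₂ : ∀ j, (stepScale d Lc (j + 1) * (Lc : ℝ) ^ (d + 1))⁻¹ * b (j + 1) = -(ξ (j + 1) * (stepScale d Lc (j + 1) * (Lc : ℝ) ^ (d + 1))))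
    (h0 : ∀ y : Fin (d + 1) → ℤ, (stepScale d Lc 0 * (Lc : ℝ) ^ (d + 1))⁻¹ • ∑ v ∈ box (d + 1) Lc, divV (S 0) ((Lc : ℤ) • y + toSite v) =
      conjV (bhKAt d (toSite r) Lc) (diagK (ξ 0 • ∑ v ∈ box (d + 1) Lc, legInd (toSite r) ((Lc : ℤ) • y + toSite v)))) :
    ∀ (j : ℕ) (y : Fin (d + 1) → ℤ),
      (stepScale d Lc j * (Lc : ℝ) ^ (d + 1))⁻¹ • ∑ v ∈ box (d + 1) Lc, divV (S j) ((Lc : ℤ) • y + toSite v) =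
        conjV (bhKStepAt d (toSite r) Lc j) (diagK (ξ j • ∑ v ∈ box (d + 1) Lc, legInd (toSite r) ((Lc : ℤ) • y + toSite v))) :=
  hSd_all hLc hr (K := fun j => coDressKBmAt (toSite r) Lc (KInvStep (d := d) Lc j)) (M := fun j => bhKStepAt d (toSite r) Lc j)
    (E := axEc (toSite r) Lc) (fun j => decays_coDressKBmAt_KInvStep hr j) (spr_bhKStepAt hr) (spr_axEc _ _)
    (relInv_coDressKBmAt_KInvStep_bhKStepAt hr) hS hδs (cH := fun j => (stepScale d Lc j * (Lc : ℝ) ^ (d + 1))⁻¹)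
    (fun j y κ' u => colH_ward_KInvStep_all hr j y κ' u) hX (fun _ _ => comp_axEc_diagK_comm _ _ _) (w := fun j => wVH d Lc j)
    (P := fun j => stepScale d Lc j * (Lc : ℝ) ^ (d + 1)) hT (fun j u => conjV_bhKStepAt_succ_diagK_legInd_step hLc (toSite r) j u) h₁ h₂ h0

/-- [folklore] **THE SAME WITH MEMBER `0` = THE ROOTED NATIVE SPINE `S0NAt ρ cE cVH cΛ`**: the level-`0` law is then leaf-05's LANDED Wilson
divergence law (`WilsonDivergenceContact.hSd_S0NAt_of_lock`, Wilson constant `1/2`), under the level-`0` lock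
`cH 0·cE·(1/2) = ξ 0`, `cH 0·cVH = −ξ 0·Lc^{d+1}` (`cH 0 = (stepScale 0·Lc^{d+1})⁻¹ = Lc^{−(d+1)}`).  NO statement-level input is left on
the S-side: the remaining hypotheses are the recursion (hT) tying the family, the localisation of the generators (hX) and the scalar locks. -/
theorem hSd_wall_all_S0NAt (hLc : 1 ≤ Lc) {r : Fin (d + 1) → ℕ} (hr : r ∈ box (d + 1) Lc) (cE cVH cΛ : ℝ)
    {S : ℕ → Fin (d + 1) → (Fin (d + 1) → ℤ) → MKer (d + 1) (Fib d)} (hS0 : S 0 = S0NAt d Lc (toSite r) cE cVH cΛ)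
    {Cs δs : ℕ → ℝ} (hS : ∀ j, LocStencil (S j) (Cs j) (δs j)) (hδs : ∀ j, 0 < δs j) {ξ a b : ℕ → ℝ}
    (hX : ∀ (j : ℕ) (y : Fin (d + 1) → ℤ), Loc (diagK (ξ j • ∑ v ∈ box (d + 1) Lc, legInd (toSite r) ((Lc : ℤ) • y + toSite v))))
    (hT : ∀ (j : ℕ) (u : Fin (d + 1) → ℤ), divV (S (j + 1)) u =
      a (j + 1) • divV (e3K (coDressKBmAt (toSite r) Lc (KInvStep (d := d) Lc j)) Lc (S j)) u + b (j + 1) • divV (vhSAt (toSite r) d Lc) u)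
    (h0₁ : (stepScale d Lc 0 * (Lc : ℝ) ^ (d + 1))⁻¹ * cE * (1 / 2) = ξ 0)
    (h0₂ : (stepScale d Lc 0 * (Lc : ℝ) ^ (d + 1))⁻¹ * cVH = -(ξ 0 * (Lc : ℝ) ^ (d + 1)))
    (h₁ : ∀ j, (stepScale d Lc (j + 1) * (Lc : ℝ) ^ (d + 1))⁻¹ * a (j + 1) * ξ j = ξ (j + 1) * wVH d Lc (j + 1))
    (h₂ : ∀ j, (stepScale d Lc (j + 1) * (Lc : ℝ) ^ (d + 1))⁻¹ * b (j + 1) = -(ξ (j + 1) * (stepScale d Lc (j + 1) * (Lc : ℝ) ^ (d + 1)))) :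
    ∀ (j : ℕ) (y : Fin (d + 1) → ℤ),
      (stepScale d Lc j * (Lc : ℝ) ^ (d + 1))⁻¹ • ∑ v ∈ box (d + 1) Lc, divV (S j) ((Lc : ℤ) • y + toSite v) =
        conjV (bhKStepAt d (toSite r) Lc j) (diagK (ξ j • ∑ v ∈ box (d + 1) Lc, legInd (toSite r) ((Lc : ℤ) • y + toSite v))) :=
  hSd_wall_all hLc hr hS hδs hX hT h₁ h₂ fun y => by rw [hS0]; exact hSd_S0NAt_of_lock hLc hr h0₁ h0₂ y

end All

/-! ## §4 THE hW-SIDE UNITS PIN: when are the step locks solvable? (pure real arithmetic over the tree's numerals) -/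

section Pin

variable {Lc : ℕ}

/-- [folklore] `wVH j = (stepScale j)²` (the tree's numerals: `wVH j = (Lc^j)^{2(d+2)}`, `stepScale j = (Lc^j)^{d+2}`). -/
theorem wVH_eq_stepScale_sq (j : ℕ) : wVH d Lc j = stepScale d Lc j ^ 2 := by
  unfold BalabanStepJetsSucc.wVH BorderedHessian.stepScale
  ring

/-- [folklore] `wE j = (stepScale j)³` (the tree's PROVISIONAL numeral `wE j = (Lc^j)^{3(d+2)}`, BCJ v1.2). -/
theorem wE_eq_stepScale_cube (j : ℕ) : wE d Lc j = stepScale d Lc j ^ 3 := by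
  unfold BalabanStepJetsSucc.wE BorderedHessian.stepScale
  ring

variable [NeZero Lc]

/-- [folklore] **THE SECOND LOCK FORCES A CONSTANT GENERATOR SCALE**: with `cH (j+1) = (stepScale (j+1)·Lc^{d+1})⁻¹`, border weight `cVH·wVH (j+1)`
and border scale `stepScale (j+1)·Lc^{d+1}`, the lock `cH·b = −ξ′·P` reads `ξ′ = −cVH/(Lc^{d+1})²` — INDEPENDENT of `j`. -/
theorem lock₂_iff (cVH : ℝ) (ξ' : ℝ) (j : ℕ) :
    (stepScale d Lc (j + 1) * (Lc : ℝ) ^ (d + 1))⁻¹ * (cVH * wVH d Lc (j + 1)) =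
        -(ξ' * (stepScale d Lc (j + 1) * (Lc : ℝ) ^ (d + 1))) ↔
      ξ' = -cVH / ((Lc : ℝ) ^ (d + 1)) ^ 2 := by
  have hL : (Lc : ℝ) ^ (d + 1) ≠ 0 := pow_ne_zero _ (by exact_mod_cast NeZero.ne Lc)
  have hs : stepScale d Lc (j + 1) ≠ 0 := stepScale_ne_zero (j + 1)
  rw [wVH_eq_stepScale_sq, inv_mul_eq_iff_eq_mul₀ (mul_ne_zero hs hL), eq_div_iff (pow_ne_zero 2 hL)]
  constructor
  · intro h
    have h' : stepScale d Lc (j + 1) ^ 2 * (ξ' * ((Lc : ℝ) ^ (d + 1)) ^ 2 + cVH) = 0 := by linear_combination h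
    rcases mul_eq_zero.1 h' with h0 | h0
    · exact absurd h0 (pow_ne_zero 2 hs)
    · linarith
  · intro h
    linear_combination (stepScale d Lc (j + 1)) ^ 2 * h

/-- [folklore] **THE FIRST LOCK AT A CONSTANT GENERATOR SCALE PINS THE CUBIC WEIGHT**: with cubic weight `cE·wE′`, field weight `wVH (j+1)`
and `ξ (j+1) = ξ j = ξ₀ ≠ 0`, the lock `cH·a·ξ j = ξ (j+1)·w` reads `cE·wE′ = (stepScale (j+1))³·Lc^{d+1}`. -/
theorem lock₁_iff {ξ₀ : ℝ} (hξ : ξ₀ ≠ 0) (cE wE' : ℝ) (j : ℕ) :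
    (stepScale d Lc (j + 1) * (Lc : ℝ) ^ (d + 1))⁻¹ * (cE * wE') * ξ₀ = ξ₀ * wVH d Lc (j + 1) ↔
      cE * wE' = stepScale d Lc (j + 1) ^ 3 * (Lc : ℝ) ^ (d + 1) := by
  have hL : (Lc : ℝ) ^ (d + 1) ≠ 0 := pow_ne_zero _ (by exact_mod_cast NeZero.ne Lc)
  have hs : stepScale d Lc (j + 1) ≠ 0 := stepScale_ne_zero (j + 1)
  rw [wVH_eq_stepScale_sq, mul_assoc, inv_mul_eq_iff_eq_mul₀ (mul_ne_zero hs hL)]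
  constructor
  · intro h
    have h' : ξ₀ * (cE * wE' - stepScale d Lc (j + 1) ^ 3 * (Lc : ℝ) ^ (d + 1)) = 0 := by linear_combination h
    rcases mul_eq_zero.1 h' with h0 | h0
    · exact absurd h0 hξ
    · linarith
  · intro h
    linear_combination ξ₀ * h

/-- [folklore] **THE STEP LOCKS, SOLVED (hW-side units pin).**  Under the LEVEL-`0` LOCK `ξ 0 = cE·cE′/Lc^{d+1}`, `cVH = −cE·cE′·Lc^{d+1}`
(`cE·cE′ ≠ 0`), with cubic weights `a (j+1) = cE·wE′ (j+1)` (`wE′` SYMBOLIC), border weights `b (j+1) = cVH·wVH (j+1)` and the wall's `cH`, `wVH`,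
`stepScale·Lc^{d+1}`: the locks of `hSd_wall_all` hold at EVERY step IFF `ξ` is constant AND `cE·wE′ (j+1) = (stepScale (j+1))³·Lc^{d+1}` for every `j`. -/
theorem stepLocks_iff {cE cVH cE' : ℝ} (hc : cE * cE' ≠ 0) {ξ : ℕ → ℝ} (hξ0 : ξ 0 = cE * cE' / (Lc : ℝ) ^ (d + 1))
    (hcVH : cVH = -(cE * cE' * (Lc : ℝ) ^ (d + 1))) (wE' : ℕ → ℝ) :
    (∀ j, (stepScale d Lc (j + 1) * (Lc : ℝ) ^ (d + 1))⁻¹ * (cE * wE' (j + 1)) * ξ j = ξ (j + 1) * wVH d Lc (j + 1) ∧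
        (stepScale d Lc (j + 1) * (Lc : ℝ) ^ (d + 1))⁻¹ * (cVH * wVH d Lc (j + 1)) =
          -(ξ (j + 1) * (stepScale d Lc (j + 1) * (Lc : ℝ) ^ (d + 1)))) ↔
      (∀ j, ξ (j + 1) = ξ 0) ∧ ∀ j, cE * wE' (j + 1) = stepScale d Lc (j + 1) ^ 3 * (Lc : ℝ) ^ (d + 1) := by
  have hL : (Lc : ℝ) ^ (d + 1) ≠ 0 := pow_ne_zero _ (by exact_mod_cast NeZero.ne Lc)
  have hξ0' : ξ 0 ≠ 0 := by rw [hξ0]; exact div_ne_zero hc hL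
  -- the value the second lock forces IS `ξ 0`
  have hval : -cVH / ((Lc : ℝ) ^ (d + 1)) ^ 2 = ξ 0 := by
    rw [hcVH, hξ0, neg_neg, pow_two, mul_div_mul_right _ _ hL]
  have hconst : ∀ j, ((stepScale d Lc (j + 1) * (Lc : ℝ) ^ (d + 1))⁻¹ * (cVH * wVH d Lc (j + 1)) =
      -(ξ (j + 1) * (stepScale d Lc (j + 1) * (Lc : ℝ) ^ (d + 1))) ↔ ξ (j + 1) = ξ 0) := fun j => by
    rw [lock₂_iff, hval]
  constructor
  · intro h
    have hc' : ∀ j, ξ (j + 1) = ξ 0 := fun j => (hconst j).1 (h j).2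
    have hall : ∀ j, ξ j = ξ 0 := fun j => by
      cases j with
      | zero => rfl
      | succ j => exact hc' j
    refine ⟨hc', fun j => ?_⟩
    have h1 := (h j).1
    rw [hall j, hc' j] at h1
    exact (lock₁_iff hξ0' cE (wE' (j + 1)) j).1 h1
  · rintro ⟨hc', hw⟩ j
    have hall : ∀ j, ξ j = ξ 0 := fun j => by
      cases j with
      | zero => rfl
      | succ j => exact hc' j
    refine ⟨?_, (hconst j).2 (hc' j)⟩
    rw [hall j, hc' j]
    exact (lock₁_iff hξ0' cE (wE' (j + 1)) j).2 (hw j)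

/-- [folklore] **AT THE TREE'S NUMERAL `wE′ = wE = stepScale³` THE PIN IS `cE = Lc^{d+1}`** (`wE_eq_stepScale_cube`): under the level-`0` lock the
step locks hold at every level iff `ξ` is constant and `cE = Lc^{d+1}` — the hW-side reading of an3-g29's «(L3)-dressed wants `cE = Lc^{d+1}`»
and of an2's `cE = wVH(1)²·Lc^{d+1}/(s·wE(1))` (GAP C-an2-75(b)), both obtained from the REFLECTION binder. -/
theorem stepLocks_bcj_iff {cE cVH cE' : ℝ} (hc : cE * cE' ≠ 0) {ξ : ℕ → ℝ} (hξ0 : ξ 0 = cE * cE' / (Lc : ℝ) ^ (d + 1))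
    (hcVH : cVH = -(cE * cE' * (Lc : ℝ) ^ (d + 1))) :
    (∀ j, (stepScale d Lc (j + 1) * (Lc : ℝ) ^ (d + 1))⁻¹ * (cE * wE d Lc (j + 1)) * ξ j = ξ (j + 1) * wVH d Lc (j + 1) ∧
        (stepScale d Lc (j + 1) * (Lc : ℝ) ^ (d + 1))⁻¹ * (cVH * wVH d Lc (j + 1)) =
          -(ξ (j + 1) * (stepScale d Lc (j + 1) * (Lc : ℝ) ^ (d + 1)))) ↔
      (∀ j, ξ (j + 1) = ξ 0) ∧ cE = (Lc : ℝ) ^ (d + 1) := by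
  rw [stepLocks_iff hc hξ0 hcVH (fun j => wE d Lc j)]
  refine and_congr Iff.rfl ⟨fun h => ?_, fun h j => ?_⟩
  · have h0 := h 0
    rw [wE_eq_stepScale_cube] at h0
    have h' : (cE - (Lc : ℝ) ^ (d + 1)) * stepScale d Lc (0 + 1) ^ 3 = 0 := by linear_combination h0
    rcases mul_eq_zero.1 h' with h1 | h1
    · linarith
    · exact absurd h1 (pow_ne_zero _ (stepScale_ne_zero (0 + 1)))
  · rw [wE_eq_stepScale_cube]
    linear_combination stepScale d Lc (j + 1) ^ 3 * h

/-- [folklore] **AT `cE = 2` THE PIN IS THE RE-PINNED CUBIC WEIGHT `wE′ (j+1) = wE (j+1)·Lc^{d+1}/2`** (an2's recommended repair of C-an2-75(b),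
`wE(1) := wVH(1)²·Lc^{d+1}/(2·s)`, here at every level, with the SAME `j`-independent factor `Lc^{d+1}/2`). -/
theorem stepLocks_two_iff {cVH cE' : ℝ} (hc : (2 : ℝ) * cE' ≠ 0) {ξ : ℕ → ℝ} (hξ0 : ξ 0 = 2 * cE' / (Lc : ℝ) ^ (d + 1))
    (hcVH : cVH = -(2 * cE' * (Lc : ℝ) ^ (d + 1))) (wE' : ℕ → ℝ) :
    (∀ j, (stepScale d Lc (j + 1) * (Lc : ℝ) ^ (d + 1))⁻¹ * (2 * wE' (j + 1)) * ξ j = ξ (j + 1) * wVH d Lc (j + 1) ∧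
        (stepScale d Lc (j + 1) * (Lc : ℝ) ^ (d + 1))⁻¹ * (cVH * wVH d Lc (j + 1)) =
          -(ξ (j + 1) * (stepScale d Lc (j + 1) * (Lc : ℝ) ^ (d + 1)))) ↔
      (∀ j, ξ (j + 1) = ξ 0) ∧ ∀ j, wE' (j + 1) = wE d Lc (j + 1) * (Lc : ℝ) ^ (d + 1) / 2 := by
  rw [stepLocks_iff hc hξ0 hcVH wE']
  refine and_congr Iff.rfl (forall_congr' fun j => ?_)
  rw [wE_eq_stepScale_cube]
  constructor
  · intro h
    linear_combination h / 2
  · intro h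
    linear_combination 2 * h

end Pin

end Summit.QuantumFields.BalabanUV.Beta.WardLocusInduction

end
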